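import Mathlib
import Summits.Ventures.PercRepro2.A3CutCrossFibres
import Summits.Ventures.PercRepro2.A3CutFMoTerms

/-!
# The cross-shield: the explored cut vertex `x` separates `{a₁, o}` from `{a₂, b}` — the `S`-sums
at a fixed `T`
(blind cell PercRepro2, night-1 g33; proofs/NIGHT1-G33.md §7; the assembly is A3CutCrossShield.lean)

Setting of A3CutCrossFibres.  Every fibre sum of the `x`-exploration is a double sum over the pairs
`(S, T)`, `x ∈ T` (`sum_cross_pairs`).  At a fixed `T` the `S`-sums are closed forms in the `A`-atoms
`A₀ = ∑_{S ∌ a₁} α(S)`, `A₁ = ∑_{S ∋ a₁} α(S)`, `Aρ₀ = ∑_{S ∌ a₁} α_o(S)`: when `a₂ ∈ T` only the pairs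
with `a₁ ∉ S` survive (`sum_S_mW_of_mem`, `sum_S_Ssig_b_of_mem`, `sum_S_SFg_of_mem`,
`sum_S_term_of_mem`), when `a₂ ∉ T` the two classes `a₁ ∈ S` / `a₁ ∉ S` contribute
(`sum_S_mW_of_notMem`, `sum_S_Ssig_b_of_notMem`, `sum_S_SFg_of_notMem`, `sum_S_term_of_notMem`).
Standard axioms.
-/

namespace Summit.Ventures.PercRepro2

open UnionCluster CovForm CutV

namespace CovForm

namespace A3Fibre

namespace CrossShield

section Sums

variable {V : Type*} {E : Type*} [Fintype V] [DecidableEq V] [Fintype E] [DecidableEq E]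
  {R : Type*} [Field R] [LinearOrder R] [IsStrictOrderedRing R] {ends : E → Sym2 V} {x : V}
  {VA VB : Finset V} {EA EB : Set E} [DecidablePred (· ∈ EA)] [DecidablePred (· ∈ EB)] {p : E → R}
  {a₁ a₂ o b : V}

/-! ## The double sum over the pairs -/

omit [Fintype V] [DecidableEq V] [Fintype E] [DecidableEq E] [Field R] [LinearOrder R]
  [IsStrictOrderedRing R] [DecidablePred (· ∈ EA)] [DecidablePred (· ∈ EB)] in
/-- The fibre of `x` at a set not containing `x` is empty. -/
lemma fibre_eq_empty_of_notMem_x (ends : E → Sym2 V) (a₁ a₂ x : V) {W : Finset V} (hW : x ∉ W) :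
    fibre ends a₁ a₂ x W = ∅ := by
  unfold fibre
  rw [clusterEvent_x_eq_empty_of_notMem hW, Set.inter_empty]

omit [Fintype V] [Fintype E] [DecidableEq E] [Field R] [LinearOrder R] [IsStrictOrderedRing R]
  [DecidablePred (· ∈ EA)] [DecidablePred (· ∈ EB)] in
/-- The fibre of `x` at a set not inside `VA ∪ VB ∪ {x}` is empty. -/
lemma fibre_eq_empty_of_not_subset' (h : IsCut ends x ↑VA ↑VB EA EB) (a₁ a₂ : V) {W : Finset V}
    (hW : ¬ W ⊆ VA ∪ insert x VB) : fibre ends a₁ a₂ x W = ∅ := by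
  unfold fibre
  rw [clusterEvent_x_eq_empty_of_not_subset h hW, Set.inter_empty]

omit [Fintype E] [DecidableEq E] [LinearOrder R] [IsStrictOrderedRing R] [DecidablePred (· ∈ EA)]
  [DecidablePred (· ∈ EB)] in
/-- **Every sum over the fibres of `x` is a double sum over the pairs `(S, T)`, `x ∈ T`.** -/
lemma sum_cross_pairs (h : IsCut ends x ↑VA ↑VB EA EB) (a₁ a₂ : V) (f : Finset V → R)
    (hf : ∀ W, fibre ends a₁ a₂ x W = ∅ → f W = 0) :
    ∑ W, f W =
      ∑ T ∈ (insert x VB).powerset.filter (fun T => x ∈ T), ∑ S ∈ VA.powerset, f (S ∪ T) := by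
  rw [sum_eq_sum_pairs VA (insert x VB) (disjoint_VA_insert h) f
    (fun W hW => hf W (fibre_eq_empty_of_not_subset' h a₁ a₂ hW)), Finset.sum_comm]
  symm
  apply Finset.sum_filter_of_ne
  intro T _ hT
  by_contra hxT
  apply hT
  refine Finset.sum_eq_zero fun S hS => ?_
  rw [Finset.mem_powerset] at hS
  refine hf _ (fibre_eq_empty_of_notMem_x ends a₁ a₂ x ?_)
  intro hc
  rcases Finset.mem_union.1 hc with hc | hc
  · exact h.x_notA (Finset.mem_coe.2 (hS hc))
  · exact hxT hc

omit [Fintype V] [Fintype E] [DecidableEq E] [Field R] [LinearOrder R] [IsStrictOrderedRing R]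
  [DecidablePred (· ∈ EA)] [DecidablePred (· ∈ EB)] in
/-- `x ∈ T ⊆ VB ∪ {x}` from membership in the index set. -/
lemma mem_TT {T : Finset V} (hT : T ∈ (insert x VB).powerset.filter (fun T => x ∈ T)) :
    T ⊆ insert x VB ∧ x ∈ T := by
  rw [Finset.mem_filter, Finset.mem_powerset] at hT
  exact hT

omit [Fintype V] [DecidableEq V] [LinearOrder R] [IsStrictOrderedRing R] [DecidablePred (· ∈ EA)]
  [DecidablePred (· ∈ EB)] in
/-- The masses of an empty fibre vanish. -/
lemma masses_eq_zero_of_fibre_eq_empty' {W : Finset V} (hW : fibre ends a₁ a₂ x W = ∅) (y : V) :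
    mW p ends a₁ a₂ x W = 0 ∧ Ssig p ends a₁ a₂ x y W = 0 ∧ Su p ends a₁ a₂ x y W = 0 := by
  unfold mW Ssig Su
  rw [hW]
  simp

/-! ## Null factors -/

omit [Fintype V] [DecidablePred (· ∈ EB)] in
/-- `α_o(S) = 0` when `α(S) = 0`. -/
lemma alphaO_eq_zero (hp : IsProbVec p) {S : Finset V} (h0 : alphaS p ends EA x S = 0)
    (a₁ o : V) : alphaO p ends EA x a₁ o S = 0 := by
  unfold alphaS at h0
  unfold alphaO
  have key := prob_mono hp (show sideEvent EA (clusterEvent ends x (↑(insert x S) : Set V) ∩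
      connEvent ends a₁ o) ⊆ sideEvent EA (clusterEvent ends x (↑(insert x S) : Set V)) from
    fun _ hω => hω.1)
  rw [h0] at key
  exact le_antisymm key (prob_nonneg hp _)

omit [Fintype V] [DecidableEq V] [DecidablePred (· ∈ EA)] in
/-- `μ_b(T) = 0` when `μ(T) = 0`. -/
lemma muB_eq_zero (hp : IsProbVec p) {T : Finset V} (h0 : muT p ends EB x T = 0) (a₂ b : V) :
    muB p ends EB x a₂ b T = 0 := by
  unfold muT at h0
  unfold muB
  have key := prob_mono hp (show sideEvent EB (clusterEvent ends x (↑T : Set V) ∩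
      connEvent ends a₂ b) ⊆ sideEvent EB (clusterEvent ends x (↑T : Set V)) from fun _ hω => hω.1)
  rw [h0] at key
  exact le_antisymm key (prob_nonneg hp _)

/-! ## Splitting the `S`-sum -/

omit [Fintype V] [Fintype E] [DecidableEq E] [LinearOrder R] [IsStrictOrderedRing R]
  [DecidablePred (· ∈ EA)] [DecidablePred (· ∈ EB)] in
/-- A sum over `S ⊆ VA` splits by `a₁ ∈ S`. -/
lemma sum_S_split (g : Finset V → R) :
    ∑ S ∈ VA.powerset, g S =
      ∑ S ∈ VA.powerset.filter (fun S => a₁ ∈ S), g S +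
        ∑ S ∈ VA.powerset.filter (fun S => a₁ ∉ S), g S :=
  (Finset.sum_filter_add_sum_filter_not VA.powerset (fun S => a₁ ∈ S) g).symm

omit [Fintype V] [Fintype E] [DecidableEq E] [LinearOrder R] [IsStrictOrderedRing R]
  [DecidablePred (· ∈ EA)] [DecidablePred (· ∈ EB)] in
/-- A sum over `S ⊆ VA` vanishing on `a₁ ∈ S` is the sum over `a₁ ∉ S`. -/
lemma sum_S_restrict (g : Finset V → R) (hg : ∀ S ∈ VA.powerset, a₁ ∈ S → g S = 0) :
    ∑ S ∈ VA.powerset, g S = ∑ S ∈ VA.powerset.filter (fun S => a₁ ∉ S), g S :=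
  (Finset.sum_filter_of_ne (p := fun S => a₁ ∉ S) fun S hS hne h1 => hne (hg S hS h1)).symm

/-! ## The `S`-sums at a fixed `T`, case `a₂ ∈ T`: only `a₁ ∉ S` survives -/

omit [Fintype V] [LinearOrder R] [IsStrictOrderedRing R] in
/-- `∑_S m_{S ∪ T} = μ(T) A₀` when `a₂ ∈ T`. -/
lemma sum_S_mW_of_mem (h : IsCut ends x ↑VA ↑VB EA EB) (ha1 : a₁ ∈ VA) (ha2 : a₂ ∈ insert x VB)
    {T : Finset V} (hT : T ⊆ insert x VB) (hxT : x ∈ T) (h2 : a₂ ∈ T) :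
    ∑ S ∈ VA.powerset, mW p ends a₁ a₂ x (S ∪ T) =
      muT p ends EB x T * ∑ S ∈ VA.powerset.filter (fun S => a₁ ∉ S), alphaS p ends EA x S := by
  rw [sum_S_restrict _ fun S hS h1 =>
    (masses_cross_zero h ha1 ha2 (Finset.mem_powerset.1 hS) hT hxT h1 h2 x).1, Finset.mul_sum]
  refine Finset.sum_congr rfl fun S hS => ?_
  rw [Finset.mem_filter, Finset.mem_powerset] at hS
  rw [mW_cross h ha1 ha2 hS.1 hT hxT (fun hc => hS.2 hc.1), mul_comm]

omit [Fintype V] [LinearOrder R] [IsStrictOrderedRing R] in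
/-- `∑_S Sb_{S ∪ T} = −μ_b(T) A₀` when `a₂ ∈ T`. -/
lemma sum_S_Ssig_b_of_mem (h : IsCut ends x ↑VA ↑VB EA EB) (ha1 : a₁ ∈ VA)
    (ha2 : a₂ ∈ insert x VB) (hb : b ∈ insert x VB) {T : Finset V} (hT : T ⊆ insert x VB)
    (hxT : x ∈ T) (h2 : a₂ ∈ T) :
    ∑ S ∈ VA.powerset, Ssig p ends a₁ a₂ x b (S ∪ T) =
      -(muB p ends EB x a₂ b T *
        ∑ S ∈ VA.powerset.filter (fun S => a₁ ∉ S), alphaS p ends EA x S) := by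
  rw [sum_S_restrict _ fun S hS h1 =>
    (masses_cross_zero h ha1 ha2 (Finset.mem_powerset.1 hS) hT hxT h1 h2 b).2.1, Finset.mul_sum,
    ← Finset.sum_neg_distrib]
  refine Finset.sum_congr rfl fun S hS => ?_
  rw [Finset.mem_filter, Finset.mem_powerset] at hS
  rw [Ssig_b_cross h ha1 ha2 hb hS.1 hT hxT (fun hc => hS.2 hc.1),
    if_neg (show ¬ (a₁ ∈ S ∧ b ∈ T) from fun hc => hS.2 hc.1)]
  ring

omit [Fintype V] [LinearOrder R] [IsStrictOrderedRing R] in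
/-- `∑_S SFg(γ)_{S ∪ T} = μ(T)(2 Aρ₀ − γ A₀)` when `a₂ ∈ T`. -/
lemma sum_S_SFg_of_mem (h : IsCut ends x ↑VA ↑VB EA EB) (ha1 : a₁ ∈ VA) (ho : o ∈ VA)
    (ha2 : a₂ ∈ insert x VB) {T : Finset V} (hT : T ⊆ insert x VB) (hxT : x ∈ T) (h2 : a₂ ∈ T)
    (γ : R) :
    ∑ S ∈ VA.powerset, RootEdge.SFg p ends o a₁ a₂ x γ (S ∪ T) =
      muT p ends EB x T *
        (2 * ∑ S ∈ VA.powerset.filter (fun S => a₁ ∉ S), alphaO p ends EA x a₁ o S -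
          γ * ∑ S ∈ VA.powerset.filter (fun S => a₁ ∉ S), alphaS p ends EA x S) := by
  rw [sum_S_restrict _ fun S hS h1 => ?_, Finset.mul_sum, Finset.mul_sum, ← Finset.sum_sub_distrib,
    Finset.mul_sum]
  · refine Finset.sum_congr rfl fun S hS => ?_
    rw [Finset.mem_filter, Finset.mem_powerset] at hS
    have hok : ¬ (a₁ ∈ S ∧ a₂ ∈ T) := fun hc => hS.2 hc.1
    unfold RootEdge.SFg
    rw [Ssig_o_cross h ha1 ho ha2 hS.1 hT hxT hok, Su_o_cross h ha1 ho ha2 hS.1 hT hxT hok,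
      mW_cross h ha1 ha2 hS.1 hT hxT hok, s3_cross h ha1 ha2 hS.1 hT hok,
      if_neg (show ¬ a₁ ∈ S from hS.2), if_pos (show a₂ ∈ T from h2)]
    ring
  · obtain ⟨hm, hs, hu⟩ := masses_cross_zero (p := p) h ha1 ha2 (Finset.mem_powerset.1 hS) hT hxT h1 h2 o
    unfold RootEdge.SFg
    rw [hm, hs, hu]
    ring

omit [Fintype V] in
/-- `∑_S Sb · SFg(γ) / m` at `S ∪ T`: `−μ_b(T)(2 Aρ₀ − γ A₀)` when `a₂ ∈ T`. -/
lemma sum_S_term_of_mem (hp : IsProbVec p) (h : IsCut ends x ↑VA ↑VB EA EB) (ha1 : a₁ ∈ VA)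
    (ho : o ∈ VA) (ha2 : a₂ ∈ insert x VB) (hb : b ∈ insert x VB) {T : Finset V}
    (hT : T ⊆ insert x VB) (hxT : x ∈ T) (h2 : a₂ ∈ T) (γ : R) :
    ∑ S ∈ VA.powerset, Ssig p ends a₁ a₂ x b (S ∪ T) * RootEdge.SFg p ends o a₁ a₂ x γ (S ∪ T) /
        mW p ends a₁ a₂ x (S ∪ T) =
      -(muB p ends EB x a₂ b T *
        (2 * ∑ S ∈ VA.powerset.filter (fun S => a₁ ∉ S), alphaO p ends EA x a₁ o S -
          γ * ∑ S ∈ VA.powerset.filter (fun S => a₁ ∉ S), alphaS p ends EA x S)) := by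
  rw [sum_S_restrict _ fun S hS h1 => ?_, Finset.mul_sum, Finset.mul_sum, ← Finset.sum_sub_distrib,
    Finset.mul_sum, ← Finset.sum_neg_distrib]
  · refine Finset.sum_congr rfl fun S hS => ?_
    rw [Finset.mem_filter, Finset.mem_powerset] at hS
    have hok : ¬ (a₁ ∈ S ∧ a₂ ∈ T) := fun hc => hS.2 hc.1
    unfold RootEdge.SFg
    rw [Ssig_b_cross h ha1 ha2 hb hS.1 hT hxT hok, Ssig_o_cross h ha1 ho ha2 hS.1 hT hxT hok,
      Su_o_cross h ha1 ho ha2 hS.1 hT hxT hok, mW_cross h ha1 ha2 hS.1 hT hxT hok,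
      s3_cross h ha1 ha2 hS.1 hT hok, if_neg (show ¬ (a₁ ∈ S ∧ b ∈ T) from fun hc => hS.2 hc.1),
      if_neg (show ¬ a₁ ∈ S from hS.2), if_pos (show a₂ ∈ T from h2)]
    by_cases hα : alphaS p ends EA x S = 0
    · rw [hα, alphaO_eq_zero hp hα]
      simp
    by_cases hμ : muT p ends EB x T = 0
    · rw [hμ, muB_eq_zero hp hμ]
      simp
    · field_simp
      ring
  · rw [(masses_cross_zero (p := p) h ha1 ha2 (Finset.mem_powerset.1 hS) hT hxT h1 h2 b).2.1,
      zero_mul, zero_div]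

/-! ## The `S`-sums at a fixed `T`, case `a₂ ∉ T`: both classes contribute -/

omit [Fintype V] [LinearOrder R] [IsStrictOrderedRing R] in
/-- `∑_S m_{S ∪ T} = μ(T)(A₁ + A₀)` when `a₂ ∉ T`. -/
lemma sum_S_mW_of_notMem (h : IsCut ends x ↑VA ↑VB EA EB) (ha1 : a₁ ∈ VA) (ha2 : a₂ ∈ insert x VB)
    {T : Finset V} (hT : T ⊆ insert x VB) (hxT : x ∈ T) (h2 : a₂ ∉ T) :
    ∑ S ∈ VA.powerset, mW p ends a₁ a₂ x (S ∪ T) =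
      muT p ends EB x T *
        (∑ S ∈ VA.powerset.filter (fun S => a₁ ∈ S), alphaS p ends EA x S +
          ∑ S ∈ VA.powerset.filter (fun S => a₁ ∉ S), alphaS p ends EA x S) := by
  rw [sum_S_split, mul_add, Finset.mul_sum, Finset.mul_sum]
  congr 1
  · refine Finset.sum_congr rfl fun S hS => ?_
    rw [Finset.mem_filter, Finset.mem_powerset] at hS
    rw [mW_cross h ha1 ha2 hS.1 hT hxT (fun hc => h2 hc.2), mul_comm]
  · refine Finset.sum_congr rfl fun S hS => ?_
    rw [Finset.mem_filter, Finset.mem_powerset] at hS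
    rw [mW_cross h ha1 ha2 hS.1 hT hxT (fun hc => h2 hc.2), mul_comm]

omit [Fintype V] [LinearOrder R] [IsStrictOrderedRing R] in
/-- `∑_S Sb_{S ∪ T}` when `a₂ ∉ T`. -/
lemma sum_S_Ssig_b_of_notMem (h : IsCut ends x ↑VA ↑VB EA EB) (ha1 : a₁ ∈ VA)
    (ha2 : a₂ ∈ insert x VB) (hb : b ∈ insert x VB) {T : Finset V} (hT : T ⊆ insert x VB)
    (hxT : x ∈ T) (h2 : a₂ ∉ T) :
    ∑ S ∈ VA.powerset, Ssig p ends a₁ a₂ x b (S ∪ T) =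
      ((if b ∈ T then muT p ends EB x T else 0) - muB p ends EB x a₂ b T) *
          ∑ S ∈ VA.powerset.filter (fun S => a₁ ∈ S), alphaS p ends EA x S -
        muB p ends EB x a₂ b T * ∑ S ∈ VA.powerset.filter (fun S => a₁ ∉ S), alphaS p ends EA x S := by
  rw [sum_S_split, Finset.mul_sum, Finset.mul_sum, sub_eq_add_neg, ← Finset.sum_neg_distrib]
  congr 1
  · refine Finset.sum_congr rfl fun S hS => ?_
    rw [Finset.mem_filter, Finset.mem_powerset] at hS
    rw [Ssig_b_cross h ha1 ha2 hb hS.1 hT hxT (fun hc => h2 hc.2)]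
    by_cases hbT : b ∈ T
    · rw [if_pos (show a₁ ∈ S ∧ b ∈ T from ⟨hS.2, hbT⟩), if_pos hbT]
    · rw [if_neg (show ¬ (a₁ ∈ S ∧ b ∈ T) from fun hc => hbT hc.2), if_neg hbT]
  · refine Finset.sum_congr rfl fun S hS => ?_
    rw [Finset.mem_filter, Finset.mem_powerset] at hS
    rw [Ssig_b_cross h ha1 ha2 hb hS.1 hT hxT (fun hc => h2 hc.2),
      if_neg (show ¬ (a₁ ∈ S ∧ b ∈ T) from fun hc => hS.2 hc.1)]
    ring

omit [Fintype V] [LinearOrder R] [IsStrictOrderedRing R] in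
/-- `∑_S SFg(γ)_{S ∪ T} = μ(T)(γ A₁ + Aρ₀)` when `a₂ ∉ T`. -/
lemma sum_S_SFg_of_notMem (h : IsCut ends x ↑VA ↑VB EA EB) (ha1 : a₁ ∈ VA) (ho : o ∈ VA)
    (ha2 : a₂ ∈ insert x VB) {T : Finset V} (hT : T ⊆ insert x VB) (hxT : x ∈ T) (h2 : a₂ ∉ T)
    (γ : R) :
    ∑ S ∈ VA.powerset, RootEdge.SFg p ends o a₁ a₂ x γ (S ∪ T) =
      muT p ends EB x T *
        (γ * ∑ S ∈ VA.powerset.filter (fun S => a₁ ∈ S), alphaS p ends EA x S +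
          ∑ S ∈ VA.powerset.filter (fun S => a₁ ∉ S), alphaO p ends EA x a₁ o S) := by
  rw [sum_S_split, mul_add, Finset.mul_sum, Finset.mul_sum, Finset.mul_sum]
  congr 1
  · refine Finset.sum_congr rfl fun S hS => ?_
    rw [Finset.mem_filter, Finset.mem_powerset] at hS
    have hok : ¬ (a₁ ∈ S ∧ a₂ ∈ T) := fun hc => h2 hc.2
    unfold RootEdge.SFg
    rw [Ssig_o_cross h ha1 ho ha2 hS.1 hT hxT hok, Su_o_cross h ha1 ho ha2 hS.1 hT hxT hok,
      mW_cross h ha1 ha2 hS.1 hT hxT hok, s3_cross h ha1 ha2 hS.1 hT hok,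
      if_pos (show a₁ ∈ S from hS.2), if_neg (show ¬ a₂ ∈ T from h2),
      if_neg (show ¬ (o ∈ S ∧ a₂ ∈ T) from fun hc => h2 hc.2)]
    ring
  · refine Finset.sum_congr rfl fun S hS => ?_
    rw [Finset.mem_filter, Finset.mem_powerset] at hS
    have hok : ¬ (a₁ ∈ S ∧ a₂ ∈ T) := fun hc => h2 hc.2
    unfold RootEdge.SFg
    rw [Ssig_o_cross h ha1 ho ha2 hS.1 hT hxT hok, Su_o_cross h ha1 ho ha2 hS.1 hT hxT hok,
      mW_cross h ha1 ha2 hS.1 hT hxT hok, s3_cross h ha1 ha2 hS.1 hT hok,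
      if_neg (show ¬ a₁ ∈ S from hS.2), if_neg (show ¬ a₂ ∈ T from h2),
      if_neg (show ¬ (o ∈ S ∧ a₂ ∈ T) from fun hc => h2 hc.2)]
    ring

omit [Fintype V] in
/-- `∑_S Sb · SFg(γ) / m` at `S ∪ T` when `a₂ ∉ T`. -/
lemma sum_S_term_of_notMem (hp : IsProbVec p) (h : IsCut ends x ↑VA ↑VB EA EB) (ha1 : a₁ ∈ VA)
    (ho : o ∈ VA) (ha2 : a₂ ∈ insert x VB) (hb : b ∈ insert x VB) {T : Finset V}
    (hT : T ⊆ insert x VB) (hxT : x ∈ T) (h2 : a₂ ∉ T) (γ : R) :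
    ∑ S ∈ VA.powerset, Ssig p ends a₁ a₂ x b (S ∪ T) * RootEdge.SFg p ends o a₁ a₂ x γ (S ∪ T) /
        mW p ends a₁ a₂ x (S ∪ T) =
      γ * ((if b ∈ T then muT p ends EB x T else 0) - muB p ends EB x a₂ b T) *
          ∑ S ∈ VA.powerset.filter (fun S => a₁ ∈ S), alphaS p ends EA x S -
        muB p ends EB x a₂ b T *
          ∑ S ∈ VA.powerset.filter (fun S => a₁ ∉ S), alphaO p ends EA x a₁ o S := by
  rw [sum_S_split, Finset.mul_sum, Finset.mul_sum, sub_eq_add_neg, ← Finset.sum_neg_distrib]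
  congr 1
  · refine Finset.sum_congr rfl fun S hS => ?_
    rw [Finset.mem_filter, Finset.mem_powerset] at hS
    have hok : ¬ (a₁ ∈ S ∧ a₂ ∈ T) := fun hc => h2 hc.2
    unfold RootEdge.SFg
    rw [Ssig_b_cross h ha1 ha2 hb hS.1 hT hxT hok, Ssig_o_cross h ha1 ho ha2 hS.1 hT hxT hok,
      Su_o_cross h ha1 ho ha2 hS.1 hT hxT hok, mW_cross h ha1 ha2 hS.1 hT hxT hok,
      s3_cross h ha1 ha2 hS.1 hT hok, if_pos (show a₁ ∈ S from hS.2),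
      if_neg (show ¬ a₂ ∈ T from h2), if_neg (show ¬ (o ∈ S ∧ a₂ ∈ T) from fun hc => h2 hc.2)]
    have hb' : (if a₁ ∈ S ∧ b ∈ T then muT p ends EB x T else 0) =
        (if b ∈ T then muT p ends EB x T else 0) := by
      by_cases hbT : b ∈ T
      · rw [if_pos (show a₁ ∈ S ∧ b ∈ T from ⟨hS.2, hbT⟩), if_pos hbT]
      · rw [if_neg (show ¬ (a₁ ∈ S ∧ b ∈ T) from fun hc => hbT hc.2), if_neg hbT]
    rw [hb']
    by_cases hα : alphaS p ends EA x S = 0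
    · rw [hα, alphaO_eq_zero hp hα]
      simp
    by_cases hμ : muT p ends EB x T = 0
    · rw [hμ, muB_eq_zero hp hμ]
      simp
    · field_simp
      ring
  · refine Finset.sum_congr rfl fun S hS => ?_
    rw [Finset.mem_filter, Finset.mem_powerset] at hS
    have hok : ¬ (a₁ ∈ S ∧ a₂ ∈ T) := fun hc => h2 hc.2
    unfold RootEdge.SFg
    rw [Ssig_b_cross h ha1 ha2 hb hS.1 hT hxT hok, Ssig_o_cross h ha1 ho ha2 hS.1 hT hxT hok,
      Su_o_cross h ha1 ho ha2 hS.1 hT hxT hok, mW_cross h ha1 ha2 hS.1 hT hxT hok,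
      s3_cross h ha1 ha2 hS.1 hT hok, if_neg (show ¬ (a₁ ∈ S ∧ b ∈ T) from fun hc => hS.2 hc.1),
      if_neg (show ¬ a₁ ∈ S from hS.2), if_neg (show ¬ a₂ ∈ T from h2),
      if_neg (show ¬ (o ∈ S ∧ a₂ ∈ T) from fun hc => h2 hc.2)]
    by_cases hα : alphaS p ends EA x S = 0
    · rw [hα, alphaO_eq_zero hp hα]
      simp
    by_cases hμ : muT p ends EB x T = 0
    · rw [hμ, muB_eq_zero hp hμ]
      simp
    · field_simp
      ring

end Sums

end CrossShield

end A3Fibre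

end CovForm

end Summit.Ventures.PercRepro2
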